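/-
Copyright (c) 2026 the pub-hodgecm-mathlib formalisation cell (harness21).  Prover seat hodgecm-mathlib-F0P3a-p07 (g13), 2026-09-02.  Road «S3-ram» seeding wave (LEAD T11-41∕T11-60; owner F0P3a-p06 (g15));
(α₂) organ A₂ (d-ax-2) «BLOCK RANK» (residual label of a block endomorphism at an axis vertex; architect A-p12 (g23); design memo `DESIGN-A2d-TypeTwoGSide` v1.2).
-/
import Literature.LinearAlgebra.Matrix.ABVersusBAJordanStructure   -- ★ `Literature.LinearAlgebra.Matrix.rank_fromBlocks_zero₁₂_zero₂₁` (Horn–Johnson 0.9.2)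
import Mathlib.LinearAlgebra.Matrix.Rank
import Mathlib.Logic.Equiv.Fin.Basic
import HarnessLib

/-!
# The rank of a `3 × 3` matrix which is BLOCK at an index `i`: `rank S = rank S|_{W_i} + [S_{ii} ≠ 0]` (Horn–Johnson 0.9.2)

Topic `LinearAlgebra/Matrix` (filed next to the lattice-tree organs that consume it); namespace `Literature.NumberTheory.Automorphic.UnitaryLatticeTree`.  THEOREMS ONLY, Mathlib + ★ only.
Cell `pub/hodgecm-mathlib`, crux H413 = `stmt-HodgeConjecture-24833`; road «S3-ram» (count-neutral), (α₂) P-2-ram (architect A-p12 (g23)) organ A₂ (d) «type-(2) G-side counts»,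
part **(d-ax-2)**: the residual LABEL (rank of `red(c⁻¹(γ − 1))`) of a type-(2) `γ = γ_W ⊕ u` at an AXIS vertex `B ⊕ 𝒪e_i` is the block matrix's rank, which splits as the
`W`-block's rank plus `[`the line entry `≠ 0]` — applied over the residue field to `redMat` of the block matrix (★ `UnitaryLatticeTreeBlockSplitLevel` gives the level).  Seat
F0P3a-p07 (g13).  HONEST LABEL: HC_CM is proved only modulo the cell's 2 remaining named inputs (hLiu418 24832, h413 24833) until rung 0 closes; pure linear algebra.

* `submatrix_sumEquiv_eq_fromBlocks_of_block` — in the frame `Fin 2 ⊕ Unit ≃ Fin 3` (`inl j ↦ i.succAbove j`, `inr ↦ i`) a matrix block at `i` IS `fromBlocks (S|_{W_i}) 0 0 (S_{ii})`;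
* `rank_eq_rank_submatrix_succAbove_add_of_block` — **`rank S = rank (S.submatrix i.succAbove i.succAbove) + (if S_{ii} = 0 then 0 else 1)`** over any field.

## References
* [HornJohnson2013] R. A. Horn, C. R. Johnson, *Matrix Analysis*, 2nd ed. (2013), §0.9.2 (rank of a direct sum).
* [Kottwitz1986] R. E. Kottwitz, *Base change for unit elements of Hecke algebras*, Compositio Math. 60 (1986), §3 (residual data of `γ` at a fixed lattice).
-/

set_option autoImplicit false

open Matrix

namespace Literature.NumberTheory.Automorphic.UnitaryLatticeTree

variable {k : Type*} [Field k]

/-- In the frame `e : Fin 2 ⊕ Unit ≃ Fin 3`, `e (inl j) = i.succAbove j`, `e (inr ⋆) = i` (`e = (finSuccEquiv' i ⬝ optionEquivSumPUnit)⁻¹`), a matrix BLOCK at `i` (column and row `i`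
vanish off the diagonal) is the block-diagonal matrix `fromBlocks (S.submatrix i.succAbove i.succAbove) 0 0 (of fun _ _ => S i i)`. [cite: HornJohnson2013, §0.9.2] -/
theorem submatrix_sumEquiv_eq_fromBlocks_of_block (S : Matrix (Fin 3) (Fin 3) k) (i : Fin 3)
    (hcol : ∀ l, l ≠ i → S l i = 0) (hrow : ∀ l, l ≠ i → S i l = 0) :
    S.submatrix (((finSuccEquiv' i).trans (Equiv.optionEquivSumPUnit.{0, 0} (Fin 2))).symm) (((finSuccEquiv' i).trans (Equiv.optionEquivSumPUnit.{0, 0} (Fin 2))).symm) =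
      Matrix.fromBlocks (S.submatrix i.succAbove i.succAbove) 0 0 (Matrix.of fun _ _ : Unit => S i i) := by
  ext x y
  rcases x with x | x <;> rcases y with y | y <;>
    simp only [Matrix.submatrix_apply, Equiv.symm_trans_apply, Equiv.optionEquivSumPUnit_symm_inl, Equiv.optionEquivSumPUnit_symm_inr,
      finSuccEquiv'_symm_some, finSuccEquiv'_symm_none, Matrix.fromBlocks_apply₁₁, Matrix.fromBlocks_apply₁₂, Matrix.fromBlocks_apply₂₁,
      Matrix.fromBlocks_apply₂₂, Matrix.zero_apply, Matrix.of_apply]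
  · exact hcol _ (Fin.succAbove_ne i x)
  · exact hrow _ (Fin.succAbove_ne i y)

/-- **BLOCK RANK**: for a `3 × 3` matrix over a field which is BLOCK at `i` (column `i` and row `i` vanish off the diagonal),
`rank S = rank (S.submatrix i.succAbove i.succAbove) + (if S_{ii} = 0 then 0 else 1)` — the residual label of `γ_W ⊕ u` at an axis vertex splits into the `W`-label and the line's.
[cite: HornJohnson2013, §0.9.2] [cite: Kottwitz1986, §3] -/
theorem rank_eq_rank_submatrix_succAbove_add_of_block [DecidableEq k] (S : Matrix (Fin 3) (Fin 3) k) (i : Fin 3)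
    (hcol : ∀ l, l ≠ i → S l i = 0) (hrow : ∀ l, l ≠ i → S i l = 0) :
    S.rank = (S.submatrix i.succAbove i.succAbove).rank + (if S i i = 0 then 0 else 1) := by
  classical
  have h1 := Matrix.rank_submatrix S (((finSuccEquiv' i).trans (Equiv.optionEquivSumPUnit.{0, 0} (Fin 2))).symm)
    (((finSuccEquiv' i).trans (Equiv.optionEquivSumPUnit.{0, 0} (Fin 2))).symm)
  rw [submatrix_sumEquiv_eq_fromBlocks_of_block S i hcol hrow, Literature.LinearAlgebra.Matrix.rank_fromBlocks_zero₁₂_zero₂₁] at h1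
  rw [← h1]
  congr 1
  -- the `1 × 1` block: `rank (S_{ii}) = [S_{ii} ≠ 0]`
  have hD : (Matrix.of fun _ _ : Unit => S i i) = Matrix.diagonal (fun _ : Unit => S i i) := by
    ext x y
    rw [Matrix.of_apply, Matrix.diagonal_apply, if_pos (Subsingleton.elim x y)]
  rw [hD, Matrix.rank_diagonal]
  by_cases hs : S i i = 0
  · rw [if_pos hs]
    exact Fintype.card_eq_zero_iff.2 ⟨fun x => x.2 hs⟩
  · rw [if_neg hs]
    exact Fintype.card_eq_one_iff.2 ⟨⟨(), hs⟩, fun x => Subtype.ext (Subsingleton.elim _ _)⟩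

end Literature.NumberTheory.Automorphic.UnitaryLatticeTree
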